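import Mathlib
import Summits.Ventures.LatticeQCDFlow.Scaling.ImportanceWeights

/-!
# LatticeQCDFlow / Scaling — the light cone of a local flow of a product prior (T2-G)

HONEST FRAMING: exact (Metropolis-corrected) sampling algorithms for lattice gauge theory;
figures of merit are autocorrelation/cost numbers at stated couplings and volumes; no
continuum-physics claim.

Venture `LatticeQCDFlow` (cell pub-lqcd), topic `Scaling`, item T2-G of HOME/THEORY-2.md §4
(first conjunct of barrier B1 `VolumeScalingOfTraining`), landed by FANOUT row 31 from
`HOME/THEORY-2-Sketch.lean` (theory seat; v1.1 proofs, decls verbatim).  A normalizing flow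
built from `k` coupling layers of footprint `r` is an `N`-LOCAL map of link configurations
(`IsLocalMap N T`: output link `ℓ` depends only on the inputs in the receptive field `N ℓ`, the
ball of radius `k·r`).  Pushing a link-wise independent prior (`Measure.pi ν₀`, e.g. Haar per
link) through such a map cannot correlate two output blocks whose receptive fields are
disjoint:

* `indepFun_restrict_of_isLocalMap` (general measurable link space; Mathlib `iIndepFun_pi`,
  `indepFun_finset`, `IndepFun.comp`), `map_prod_eq_prod_map_of_isLocalMap` (the model law of
  the two blocks is the product of its marginals), packaged `LocalPushforwardIndep` /
  `localPushforwardIndep`;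
* finite link alphabet: `pushforward`, `productPrior`, `blockMarginal`, `pairMarginal`,
  `pairMarginal_pushforward_productPrior`, packaged `LocalPushforwardFactorises` /
  `localPushforwardFactorises` (the typed statement of record, verbatim).

This is the model-side independence that the block-defect volume law (`Scaling/BlockDefect.lean`,
T2-I) and the acceptance law (`Scaling/Bhattacharyya.lean`) consume: a depth-`k`, footprint-`r`
flow from a product prior leaves blocks `> 2kr` apart independent, so every connected
correlation of the target across such a gap is a per-block defect.
-/

namespace Summit.Ventures.LatticeQCDFlow.Theory2

open Finset

/-! ## Locality: light-cone factorisation of a local flow of a product prior (T2-G) -/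

section Locality

/-- A map of configurations `Λ → S` is `N`-local (receptive field `N ℓ` for output site/link `ℓ`).
For a composition of `k` coupling layers of footprint `r`, `N ℓ` is the ball of radius `k·r`.
[folklore] -/
def IsLocalMap {Λ S : Type*} (N : Λ → Finset Λ) (T : (Λ → S) → (Λ → S)) : Prop :=
  ∀ φ ψ : Λ → S, ∀ ℓ, (∀ ℓ' ∈ N ℓ, φ ℓ' = ψ ℓ') → T φ ℓ = T ψ ℓ

section LightCone

open MeasureTheory ProbabilityTheory Function

variable {Λ : Type*} [Fintype Λ] [DecidableEq Λ] {S : Type*} [MeasurableSpace S]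

omit [Fintype Λ] [MeasurableSpace S] in
/-- The restriction of the OUTPUT of an `N`-local map to a block `B` depends only on the input
coordinates in the receptive field `B.biUnion N`. [folklore] -/
theorem dependsOn_restrict_comp_of_isLocalMap {N : Λ → Finset Λ} {T : (Λ → S) → (Λ → S)}
    (hT : IsLocalMap N T) (B : Finset Λ) :
    DependsOn (fun φ (b : B) => T φ b) (↑(B.biUnion N) : Set Λ) := by
  intro φ ψ h
  funext b
  exact hT φ ψ b fun ℓ' hℓ' => h ℓ' (Finset.mem_coe.2 (Finset.mem_biUnion.2 ⟨b, b.2, hℓ'⟩))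

/-- **T2-G (light-cone factorisation of a local flow of a product prior).**  Let the prior make
the input coordinates independent (`Measure.pi ν₀`, e.g. Haar per link) and let `T` be `N`-local
and measurable.  If the receptive fields `B₁.biUnion N` and `B₂.biUnion N` of two output blocks
are disjoint, then the output restrictions `(T φ)|B₁` and `(T φ)|B₂` are INDEPENDENT — i.e. under
the model law `q = T_* (⊗ν₀)` the two blocks factorise.  A depth-`k`, footprint-`r` flow cannot
correlate regions more than `2kr` apart (deterministic light cone). [folklore] -/
theorem indepFun_restrict_of_isLocalMap (ν₀ : Λ → Measure S) [∀ ℓ, IsProbabilityMeasure (ν₀ ℓ)]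
    {N : Λ → Finset Λ} {T : (Λ → S) → (Λ → S)} (hT : IsLocalMap N T) (hTm : Measurable T)
    (φ₀ : Λ → S) {B₁ B₂ : Finset Λ} (hdisj : Disjoint (B₁.biUnion N) (B₂.biUnion N)) :
    IndepFun (fun φ (b : B₁) => T φ b) (fun φ (b : B₂) => T φ b) (Measure.pi ν₀) := by
  classical
  set P : Measure (Λ → S) := Measure.pi ν₀ with hP
  -- independence of the input coordinate blocks under the product prior
  have hind : iIndepFun (fun (ℓ : Λ) (φ : Λ → S) => φ ℓ) P :=
    iIndepFun_pi (X := fun (_ : Λ) (s : S) => s) fun _ => aemeasurable_id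
  have hXY : IndepFun (fun (φ : Λ → S) (i : ↥(B₁.biUnion N)) => φ i)
      (fun (φ : Λ → S) (i : ↥(B₂.biUnion N)) => φ i) P :=
    hind.indepFun_finset (B₁.biUnion N) (B₂.biUnion N) hdisj fun i => measurable_pi_apply i
  -- the output blocks factor through the input blocks (locality)
  set Φ : (Λ → S) → (↥B₁ → S) := fun φ b => T φ b with hΦ
  set Ψ : (Λ → S) → (↥B₂ → S) := fun φ b => T φ b with hΨ
  have hΦd : DependsOn Φ (↑(B₁.biUnion N) : Set Λ) := dependsOn_restrict_comp_of_isLocalMap hT B₁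
  have hΨd : DependsOn Ψ (↑(B₂.biUnion N) : Set Λ) := dependsOn_restrict_comp_of_isLocalMap hT B₂
  set Φ' : (↥(B₁.biUnion N) → S) → (↥B₁ → S) := fun y => Φ (updateFinset φ₀ (B₁.biUnion N) y)
    with hΦ'
  set Ψ' : (↥(B₂.biUnion N) → S) → (↥B₂ → S) := fun y => Ψ (updateFinset φ₀ (B₂.biUnion N) y)
    with hΨ'
  have eΦ : Φ = Φ' ∘ fun (φ : Λ → S) (i : ↥(B₁.biUnion N)) => φ i := by
    funext φ
    exact hΦd fun i hi => by simp [updateFinset, Finset.mem_coe.1 hi]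
  have eΨ : Ψ = Ψ' ∘ fun (φ : Λ → S) (i : ↥(B₂.biUnion N)) => φ i := by
    funext φ
    exact hΨd fun i hi => by simp [updateFinset, Finset.mem_coe.1 hi]
  have hΦm : Measurable Φ :=
    measurable_pi_iff.mpr fun b => (measurable_pi_apply (b : Λ)).comp hTm
  have hΨm : Measurable Ψ :=
    measurable_pi_iff.mpr fun b => (measurable_pi_apply (b : Λ)).comp hTm
  have hΦ'm : Measurable Φ' := hΦm.comp measurable_updateFinset
  have hΨ'm : Measurable Ψ' := hΨm.comp measurable_updateFinset
  show IndepFun Φ Ψ P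
  rw [eΦ, eΨ]
  exact hXY.comp hΦ'm hΨ'm

/-- The same, stated for the MODEL LAW `q = T_*(⊗ν₀)`: the joint law of the two output blocks is
the product of their marginal laws. [folklore] -/
theorem map_prod_eq_prod_map_of_isLocalMap (ν₀ : Λ → Measure S)
    [∀ ℓ, IsProbabilityMeasure (ν₀ ℓ)] {N : Λ → Finset Λ} {T : (Λ → S) → (Λ → S)}
    (hT : IsLocalMap N T) (hTm : Measurable T) (φ₀ : Λ → S) {B₁ B₂ : Finset Λ}
    (hdisj : Disjoint (B₁.biUnion N) (B₂.biUnion N)) :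
    (Measure.pi ν₀).map (fun φ => ((fun b : B₁ => T φ b), (fun b : B₂ => T φ b))) =
      ((Measure.pi ν₀).map (fun φ (b : B₁) => T φ b)).prod
        ((Measure.pi ν₀).map (fun φ (b : B₂) => T φ b)) := by
  have hΦm : Measurable (fun φ (b : B₁) => T φ b) :=
    measurable_pi_iff.mpr fun b => (measurable_pi_apply (b : Λ)).comp hTm
  have hΨm : Measurable (fun φ (b : B₂) => T φ b) :=
    measurable_pi_iff.mpr fun b => (measurable_pi_apply (b : Λ)).comp hTm
  exact (indepFun_iff_map_prod_eq_prod_map_map hΦm.aemeasurable hΨm.aemeasurable).1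
    (indepFun_restrict_of_isLocalMap ν₀ hT hTm φ₀ hdisj)

end LightCone

variable {Λ S : Type*} [Fintype Λ] [DecidableEq Λ] [Fintype S] [DecidableEq S]

/-- Pushforward `T_* ν` of a law on a finite configuration space. [folklore] -/
noncomputable def pushforward (T : (Λ → S) → (Λ → S)) (ν : (Λ → S) → ℝ) : (Λ → S) → ℝ :=
  fun ψ => ∑ φ ∈ univ.filter (fun φ => T φ = ψ), ν φ

/-- Site/link-wise independent prior (e.g. Haar per link), `ν(φ) = Π_ℓ ν₀ ℓ (φ ℓ)`. [folklore] -/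
noncomputable def productPrior (ν₀ : Λ → S → ℝ) : (Λ → S) → ℝ := fun φ => ∏ ℓ, ν₀ ℓ (φ ℓ)

/-- Law of the restriction of `μ` to a block `B`. [folklore] -/
noncomputable def blockMarginal (B : Finset Λ) (μ : (Λ → S) → ℝ) : (B → S) → ℝ :=
  fun ξ => ∑ φ ∈ univ.filter (fun φ => ∀ b : B, φ b = ξ b), μ φ

/-- Joint law of the restrictions of `μ` to two blocks. [folklore] -/
noncomputable def pairMarginal (B₁ B₂ : Finset Λ) (μ : (Λ → S) → ℝ) :
    (B₁ → S) × (B₂ → S) → ℝ :=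
  fun ξ => ∑ φ ∈ univ.filter (fun φ => (∀ b : B₁, φ b = ξ.1 b) ∧ ∀ b : B₂, φ b = ξ.2 b), μ φ

/-- Mass of an event under a pushforward = prior mass of its preimage. [folklore] -/
theorem sum_filter_pushforward (T : (Λ → S) → (Λ → S)) (ν : (Λ → S) → ℝ)
    (Q : (Λ → S) → Prop) [DecidablePred Q] :
    ∑ ψ ∈ univ.filter Q, pushforward T ν ψ = ∑ φ ∈ univ.filter (fun φ => Q (T φ)), ν φ := by
  unfold pushforward
  have h : ∀ ψ ∈ univ.filter Q, ∑ φ ∈ univ.filter (fun φ => T φ = ψ), ν φ =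
      ∑ φ ∈ (univ.filter fun φ => Q (T φ)).filter (fun φ => T φ = ψ), ν φ := by
    intro ψ hψ
    refine Finset.sum_congr ?_ fun _ _ => rfl
    ext φ
    simp only [Finset.mem_filter, Finset.mem_univ, true_and]
    exact ⟨fun h => ⟨h ▸ (Finset.mem_filter.1 hψ).2, h⟩, fun h => h.2⟩
  rw [Finset.sum_congr rfl h]
  exact Finset.sum_fiberwise_of_maps_to (fun φ hφ => by simpa using hφ) ν

omit [DecidableEq Λ] [Fintype S] [DecidableEq S] in
/-- A product prior with non-negative weights is non-negative. [folklore] -/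
theorem productPrior_nonneg {ν₀ : Λ → S → ℝ} (hν : ∀ ℓ s, 0 ≤ ν₀ ℓ s) (φ : Λ → S) :
    0 ≤ productPrior ν₀ φ :=
  Finset.prod_nonneg fun ℓ _ => hν ℓ (φ ℓ)

section WithMeasurable

open MeasureTheory ProbabilityTheory

variable [MeasurableSpace S] [MeasurableSingletonClass S]

/-- The finite prior weights `ν₀ ℓ` as a probability measure per link. [folklore] -/
noncomputable def linkMeasure (ν₀ : Λ → S → ℝ) (hν : ∀ ℓ s, 0 ≤ ν₀ ℓ s)
    (hν1 : ∀ ℓ, ∑ s, ν₀ ℓ s = 1) (ℓ : Λ) : Measure S :=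
  (PMF.ofFintype (fun s => ENNReal.ofReal (ν₀ ℓ s)) (by
    rw [← ENNReal.ofReal_sum_of_nonneg (fun s _ => hν ℓ s), hν1 ℓ, ENNReal.ofReal_one])).toMeasure

/-- `linkMeasure` is a probability measure. [folklore] -/
instance linkMeasure.isProbabilityMeasure (ν₀ : Λ → S → ℝ) (hν : ∀ ℓ s, 0 ≤ ν₀ ℓ s)
    (hν1 : ∀ ℓ, ∑ s, ν₀ ℓ s = 1) (ℓ : Λ) : IsProbabilityMeasure (linkMeasure ν₀ hν hν1 ℓ) := by
  unfold linkMeasure; infer_instance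

omit [Fintype Λ] [DecidableEq Λ] [DecidableEq S] in
/-- Singleton masses of `linkMeasure`. [folklore] -/
theorem linkMeasure_singleton (ν₀ : Λ → S → ℝ) (hν : ∀ ℓ s, 0 ≤ ν₀ ℓ s)
    (hν1 : ∀ ℓ, ∑ s, ν₀ ℓ s = 1) (ℓ : Λ) (s : S) :
    linkMeasure ν₀ hν hν1 ℓ {s} = ENNReal.ofReal (ν₀ ℓ s) := by
  rw [linkMeasure, PMF.toMeasure_apply_singleton _ _ (measurableSet_singleton _),
    PMF.ofFintype_apply]

omit [DecidableEq Λ] [DecidableEq S] in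
/-- Singleton masses of the product of the link measures = the product prior. [folklore] -/
theorem pi_linkMeasure_singleton (ν₀ : Λ → S → ℝ) (hν : ∀ ℓ s, 0 ≤ ν₀ ℓ s)
    (hν1 : ∀ ℓ, ∑ s, ν₀ ℓ s = 1) (φ : Λ → S) :
    Measure.pi (linkMeasure ν₀ hν hν1) {φ} = ENNReal.ofReal (productPrior ν₀ φ) := by
  rw [Measure.pi_singleton, productPrior,
    ENNReal.ofReal_prod_of_nonneg (fun ℓ _ => hν ℓ (φ ℓ))]
  exact Finset.prod_congr rfl fun ℓ _ => linkMeasure_singleton ν₀ hν hν1 ℓ (φ ℓ)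

omit [DecidableEq Λ] [DecidableEq S] in
/-- Finite-set masses of the product of the link measures. [folklore] -/
theorem pi_linkMeasure_finset (ν₀ : Λ → S → ℝ) (hν : ∀ ℓ s, 0 ≤ ν₀ ℓ s)
    (hν1 : ∀ ℓ, ∑ s, ν₀ ℓ s = 1) (A : Finset (Λ → S)) :
    Measure.pi (linkMeasure ν₀ hν hν1) ↑A = ENNReal.ofReal (∑ φ ∈ A, productPrior ν₀ φ) := by
  rw [← sum_measure_singleton, ENNReal.ofReal_sum_of_nonneg (fun φ _ => productPrior_nonneg hν φ)]
  exact Finset.sum_congr rfl fun φ _ => pi_linkMeasure_singleton ν₀ hν hν1 φ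

end WithMeasurable

/-- **T2-G, finite form** (the gen-1 typed statement): for a finite single-link alphabet `S`
and link-wise independent prior weights `ν₀`, the two block marginals of the model
`q = T_*(Π ν₀)` multiply when the receptive fields are disjoint. [folklore] -/
theorem pairMarginal_pushforward_productPrior (N : Λ → Finset Λ) (T : (Λ → S) → (Λ → S))
    (ν₀ : Λ → S → ℝ) (B₁ B₂ : Finset Λ) (hT : IsLocalMap N T) (hν1 : ∀ ℓ, ∑ s, ν₀ ℓ s = 1)
    (hν : ∀ ℓ s, 0 ≤ ν₀ ℓ s) (hdisj : Disjoint (B₁.biUnion N) (B₂.biUnion N)) :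
    pairMarginal B₁ B₂ (pushforward T (productPrior ν₀)) =
      prodLaw (blockMarginal B₁ (pushforward T (productPrior ν₀)))
        (blockMarginal B₂ (pushforward T (productPrior ν₀))) := by
  classical
  funext ξ
  -- reduce the three marginals of the pushforward to prior masses of preimage events
  have hpair : pairMarginal B₁ B₂ (pushforward T (productPrior ν₀)) ξ =
      ∑ φ ∈ univ.filter (fun φ => (∀ b : B₁, T φ b = ξ.1 b) ∧ ∀ b : B₂, T φ b = ξ.2 b),
        productPrior ν₀ φ := by
    unfold pairMarginal
    convert sum_filter_pushforward T (productPrior ν₀)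
      (fun ψ => (∀ b : B₁, ψ b = ξ.1 b) ∧ ∀ b : B₂, ψ b = ξ.2 b) using 2
  have hB₁ : blockMarginal B₁ (pushforward T (productPrior ν₀)) ξ.1 =
      ∑ φ ∈ univ.filter (fun φ => ∀ b : B₁, T φ b = ξ.1 b), productPrior ν₀ φ := by
    unfold blockMarginal
    convert sum_filter_pushforward T (productPrior ν₀) (fun ψ => ∀ b : B₁, ψ b = ξ.1 b) using 2
  have hB₂ : blockMarginal B₂ (pushforward T (productPrior ν₀)) ξ.2 =
      ∑ φ ∈ univ.filter (fun φ => ∀ b : B₂, T φ b = ξ.2 b), productPrior ν₀ φ := by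
    unfold blockMarginal
    convert sum_filter_pushforward T (productPrior ν₀) (fun ψ => ∀ b : B₂, ψ b = ξ.2 b) using 2
  simp only [prodLaw]
  rw [hpair, hB₁, hB₂]
  -- the empty configuration space is trivial
  rcases isEmpty_or_nonempty (Λ → S) with hE | ⟨⟨φ₀⟩⟩
  · simp [Finset.univ_eq_empty]
  -- otherwise: discrete measurable structure on `S`, product measure, independence (T2-G)
  letI : MeasurableSpace S := ⊤
  haveI : MeasurableSingletonClass S := ⟨fun _ => MeasurableSpace.measurableSet_top⟩
  have hTm : Measurable T := measurable_of_finite T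
  have hind := indepFun_restrict_of_isLocalMap (linkMeasure ν₀ hν hν1) hT hTm φ₀ hdisj
  have key := hind.measure_inter_preimage_eq_mul {ξ.1} {ξ.2} (measurableSet_singleton _)
    (measurableSet_singleton _)
  have e12 : (fun φ (b : B₁) => T φ b) ⁻¹' {ξ.1} ∩ (fun φ (b : B₂) => T φ b) ⁻¹' {ξ.2} =
      ↑(univ.filter (fun φ => (∀ b : B₁, T φ b = ξ.1 b) ∧ ∀ b : B₂, T φ b = ξ.2 b)) := by
    ext φ; simp [funext_iff]
  have e1 : (fun φ (b : B₁) => T φ b) ⁻¹' {ξ.1} =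
      ↑(univ.filter (fun φ => ∀ b : B₁, T φ b = ξ.1 b)) := by
    ext φ; simp [funext_iff]
  have e2 : (fun φ (b : B₂) => T φ b) ⁻¹' {ξ.2} =
      ↑(univ.filter (fun φ => ∀ b : B₂, T φ b = ξ.2 b)) := by
    ext φ; simp [funext_iff]
  rw [e12, e1, e2, pi_linkMeasure_finset, pi_linkMeasure_finset, pi_linkMeasure_finset,
    ← ENNReal.ofReal_mul (Finset.sum_nonneg fun φ _ => productPrior_nonneg hν φ)] at key
  exact (ENNReal.ofReal_eq_ofReal_iff (Finset.sum_nonneg fun φ _ => productPrior_nonneg hν φ)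
    (mul_nonneg (Finset.sum_nonneg fun φ _ => productPrior_nonneg hν φ)
      (Finset.sum_nonneg fun φ _ => productPrior_nonneg hν φ))).1 key

end Locality

/-- **T2-G (light-cone factorisation) — PROVED (`localPushforwardFactorises`, the gen-1 typed
finite statement verbatim).**  If `T` is `N`-local and the receptive fields of two blocks are
disjoint, then under the model `q = T_*(Π ν₀)` the two block restrictions are INDEPENDENT.
(Deterministic analogue of a Lieb–Robinson light cone: a depth-`k`, footprint-`r` flow cannot
correlate regions more than `2kr` apart.) [folklore] -/
def LocalPushforwardFactorises : Prop :=
  ∀ (Λ S : Type) [Fintype Λ] [DecidableEq Λ] [Fintype S] [DecidableEq S]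
    (N : Λ → Finset Λ) (T : (Λ → S) → (Λ → S)) (ν₀ : Λ → S → ℝ) (B₁ B₂ : Finset Λ),
    IsLocalMap N T → (∀ ℓ, ∑ s, ν₀ ℓ s = 1) → (∀ ℓ s, 0 ≤ ν₀ ℓ s) →
    Disjoint (B₁.biUnion N) (B₂.biUnion N) →
    pairMarginal B₁ B₂ (pushforward T (productPrior ν₀)) =
      prodLaw (blockMarginal B₁ (pushforward T (productPrior ν₀)))
        (blockMarginal B₂ (pushforward T (productPrior ν₀)))

/-- T2-G (finite form) holds (`pairMarginal_pushforward_productPrior`). [folklore] -/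
theorem localPushforwardFactorises : LocalPushforwardFactorises :=
  fun _ _ _ _ _ _ N T ν₀ B₁ B₂ hT hν1 hν hdisj =>
    pairMarginal_pushforward_productPrior N T ν₀ B₁ B₂ hT hν1 hν hdisj

section
open MeasureTheory ProbabilityTheory

/-- **T2-G, general form** (continuous link variables, e.g. Haar on a compact group per link; the
statement the barrier entry means physically). [folklore] -/
def LocalPushforwardIndep : Prop :=
  ∀ (Λ : Type) [Fintype Λ] [DecidableEq Λ] (S : Type) [MeasurableSpace S]
    (ν₀ : Λ → Measure S) [∀ ℓ, IsProbabilityMeasure (ν₀ ℓ)]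
    (N : Λ → Finset Λ) (T : (Λ → S) → (Λ → S)), IsLocalMap N T → Measurable T →
    ∀ (B₁ B₂ : Finset Λ), Disjoint (B₁.biUnion N) (B₂.biUnion N) →
    IndepFun (fun φ (b : B₁) => T φ b) (fun φ (b : B₂) => T φ b) (Measure.pi ν₀)

/-- T2-G (general form) holds (`indepFun_restrict_of_isLocalMap`; the base configuration it needs
exists unless the link space `S` is empty, in which case no probability measure `ν₀ ℓ` exists
either, or `Λ` is empty too). [folklore] -/
theorem localPushforwardIndep : LocalPushforwardIndep := by
  intro Λ _ _ S _ ν₀ _ N T hT hTm B₁ B₂ hdisj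
  rcases isEmpty_or_nonempty S with hS | ⟨⟨s⟩⟩
  · rcases isEmpty_or_nonempty Λ with hΛ | ⟨⟨ℓ⟩⟩
    · exact indepFun_restrict_of_isLocalMap ν₀ hT hTm (fun ℓ => (IsEmpty.false ℓ).elim) hdisj
    · have h1 : (ν₀ ℓ) Set.univ = 1 := measure_univ
      rw [Set.univ_eq_empty_iff.mpr hS, measure_empty] at h1
      exact absurd h1 zero_ne_one
  · exact indepFun_restrict_of_isLocalMap ν₀ hT hTm (fun _ => s) hdisj

end

end Summit.Ventures.LatticeQCDFlow.Theory2
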